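import Summits.HodgeConjecture.HodgeConjecture.Theses.SevenfoldWeilCensus
import Summits.HodgeConjecture.HodgeConjecture.Theses.RankFourFaces
import Literature.AlgebraicGeometry.HodgeTheory.IsoTransport
import Literature.AlgebraicGeometry.HodgeTheory.ComplexConjugationHolds
import Literature.AlgebraicGeometry.Motives.CurveNet

/-!
# Birth skeleton (BC3) — crux `HodgeAbelianDimGeEight` of route `SevenfoldWeilCensus`

Crux item `stmt-HodgeConjecture-18722`, decl
`Summit.HodgeConjecture.HodgeConjecture.Theses.SevenfoldWeilCensus.HodgeAbelianDimGeEight`: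

  `∀ A : AbelianVariety ℂ, 8 ≤ A.dim → IsSmoothProjective A.dim A.X → HodgeConjectureFor A.dim A.X`

— the Hodge conjecture for complex abelian varieties of dimension `≥ 8` (the route's declared
RESIDUAL conjunct R1: the census route attacks dimensions `≤ 7` face by face and imports this
complement). Two facts fix the shape of an honest skeleton:

1. The dimension cut is immaterial: padding with CM elliptic curves and descending along
   `A × E → A` gives `HodgeAbelianDimGeEight ↔ (HC for ALL complex abelian varieties)` — proved on
   the tree's carriers in the strategist workfile `Cruxes/AbelianComplement/R1AbsorbsLowDim.lean`
   (`hodgeAbelianDimGeEight_iff_hodgeAbelianVarieties`, standard axioms). So a plan for R1 is a plan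
   for the Hodge conjecture on all abelian varieties, and nothing is gained by typing stubs "in
   dimension `≥ 8`".
2. The only programme in print addressing all abelian varieties at once is Deligne's reduction to
   CM type (first step of "Hodge ⇒ absolute Hodge": Deligne1982HodgeCycles Prop. 6.1, PDF p. 59;
   CharlesSchnell2014Notes Thm. 11.5.11, PDF pp. 503–505, both read 2026-08-17) followed by the two
   open inputs it isolates: Grothendieck's variational Hodge conjecture along abelian schemes
   (CharlesSchnell2014Notes Conj. 11.3.1, p. 477; "very little is known", p. 479) and the Hodge
   conjecture for CM abelian varieties (Pohlmann1968; Andre1992HodgeCM; Deligne1982HodgeCycles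
   Rem. 6.3, p. 62). On the tree these are ALREADY registered obligations of the sibling route
   `RankFourFaces`: its milestone item `CMAbelianHodge` (stmt-HodgeConjecture-3052) and the two
   registered stubs of its crux `CMToAbelian` (stmt-HodgeConjecture-16267,
   `Cruxes/CMToAbelian/Lines/birth.lean`: `stub_mumfordTateCMAnchors`, `stub_abelianSchemeVHC`).

This skeleton therefore types R1 as: the two `CMToAbelian` stub statements, RESTATED VERBATIM here
(same names, same signatures — shared obligations: one proof closes the stub on both cruxes; the
`Cruxes/…/Lines` modules are workfiles, not importable library modules, hence the restatement) +
the registered item `RankFourFaces.CMAbelianHodge` BY NAME (a hypothesis admissible to the skeleton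
audit because it is a tagged route item; it is NOT re-filed as a stub):

* `stub_mumfordTateCMAnchors : MumfordTateCMAnchors` — MUMFORD–TATE CM ANCHORS (a theorem in print,
  unformalised): for every complex abelian variety `A`, smooth projective of dimension `A.dim`, and
  every rational `(p,p)`-class `c ∈ H²ᵖ(A(ℂ); ℂ)` there are a smooth projective family `f : 𝒳 ⟶ S`
  of relative dimension `A.dim` over a smooth irreducible base all of whose fibres are abelian
  varieties, points `s₁ s₀ ∈ S(ℂ)`, an iso `e : A.X ≅ 𝒳_{s₁}`, a global class `W ∈ H²ᵖ(𝒳(ℂ); ℂ)`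
  with every fibre restriction rational of type `(p,p)` and `e^*(W|_{s₁}) = c`, and a CM abelian
  variety `A₀` (`End⁰(A₀) ⊇` a commutative reduced `ℚ`-algebra of dimension `2 dim A₀` — verbatim
  the hypothesis of `CMAbelianHodge`) with `A₀.dim = A.dim` and `A₀.X ≅ 𝒳_{s₀}`. Intended witness:
  the universal abelian scheme over the connected Hodge-type Shimura variety of `MT(A)` at neat
  level (CharlesSchnell2014Notes Thm. 11.5.10, p. 503: fine moduli `𝓜_{g,d,N}`, `N ≥ 3`), `W` = the
  lift of the `MT(A)`-invariant flat section by the global invariant cycle theorem (Thm. 11.3.4,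
  p. 478), `s₀` = any special point (dense by Borel's rational-torus argument, p. 504).
  [CharlesSchnell2014Notes Thm. 11.5.11; Deligne1982HodgeCycles Prop. 6.1; Mumford1969NoteShimura]
* `stub_abelianSchemeVHC : AbelianSchemeVHC` — VARIATIONAL HODGE FOR ABELIAN SCHEMES (open): for a
  smooth projective family over a smooth irreducible base all of whose fibres are abelian `n`-folds
  and a global class `W ∈ H²ᵖ(𝒳(ℂ); ℂ)` with fibrewise rational `(p,p)` restrictions, algebraic on
  ONE fibre ⇒ algebraic on EVERY fibre. Known for `p = 1` (Lefschetz (1,1) + Thm. 11.3.4) and in the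
  MOTIVATED sense (Andre1996Motifs Thm. 0.5); open beyond. [CharlesSchnell2014Notes Conj. 11.3.1,
  Prop. 11.3.5, Cor. 11.3.6 (HC ⇒ VHC); Grothendieck1966 footnote 13; Andre1996Motifs Thm. 0.5]
* hypothesis `RankFourFaces.CMAbelianHodge` (registered item stmt-HodgeConjecture-3052, by name) —
  THE HODGE CONJECTURE FOR CM ABELIAN VARIETIES (open: ⟺ Tate for CM abelian varieties,
  Pohlmann1968; = algebraicity of Weil classes on CM abelian varieties, Andre1992HodgeCM).
* `cmToAbelian_of : MumfordTateCMAnchors → AbelianSchemeVHC → RankFourFaces.CMToAbelian` — REAL proof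
  (Deligne's reduction on the tree's carriers, as in the sibling skeleton): the Hodge-model conjunct
  of `HodgeConjectureFor` is the tree theorem `nonempty_hodgeModel_holds`; given `A` and a rational
  `(p,p)`-class `c`, stub 1 gives `(f, s₁, s₀, e, W, A₀, e₀)`; `A₀` is smooth projective of dimension
  `A₀.dim = A.dim` (`IsSmoothProjectiveFamily.isSmoothProjective` transported along `e₀`,
  `IsSmoothProjective.of_iso`); `CMAbelianHodge` at `A₀` gives HC for `A₀.X`, moved to the fibre
  `𝒳_{s₀}` along `e₀` (`forall_hodgeClass_mem_algebraicClasses_iff_of_iso`), so `W|_{s₀}` is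
  algebraic; stub 2 transports algebraicity to `W|_{s₁}`; `mem_algebraicClasses_map_iff_of_iso e`
  and `e^*(W|_{s₁}) = c` finish.
* `HodgeAbelianDimGeEight_of : MumfordTateCMAnchors → AbelianSchemeVHC → RankFourFaces.CMAbelianHodge →
  HodgeAbelianDimGeEight` — THE SKELETON THEOREM (hypotheses: the two stub statements as the
  name-keyed aliases `__Registered.stub_*`, and the registered item by name), concluding the route
  decl BY NAME: `cmToAbelian_of` applied to `CMAbelianHodge`, restricted to `8 ≤ A.dim`.
  `HodgeAbelianDimGeEight_of_stubs : RankFourFaces.CMAbelianHodge → HodgeAbelianDimGeEight` composes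
  the two sorried stubs.

No stub alone — nor the item `CMAbelianHodge` alone — gives the crux or the summit (stub 1 has no
transport and no algebraicity, stub 2 no anchor and no family through a given `A`, `CMAbelianHodge`
only CM abelian varieties: the reduction CM ⇒ all is exactly stubs 1 + 2 and is no theorem of the
tree — `RankFourFaces.CMToAbelian` is an OPEN item); all three are consequences of `HodgeConjecture`
on paper (stub 2: HC ⇒ VHC, CharlesSchnell2014Notes Cor. 11.3.6; stub 1 is a theorem). BC3 probes
(`stub → HodgeAbelianDimGeEight`, `stub → HodgeConjecture`, and the same two for `CMAbelianHodge`,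
by `exact?` / `simpa [·] using h` / `(unfold ·; aesop)` / `aesop`, one tactic per `example`) are run
in the registrar's probe file `bc/probes_v2.lean` (not importing this file) and must fail. Disproof
used: none — no `Disproof.lean` is filed on this crux (`ledger crux ls stmt-HodgeConjecture-18722`:
no workfiles, 2026-08-17). Negatives index (`ledger negatives --problem HodgeConjecture`, 3 entries:
Milnor-K exponential symbol lift, derived-Torelli Fermat K3 exhaustion, E-line transport matrix) —
disjoint from both stubs. `sorry` occurs only inside the two `stub_*` theorems.
-/

set_option linter.dupNamespace false

namespace Summit.HodgeConjecture.HodgeConjecture.Cruxes.HodgeAbelianDimGeEight.Birth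

open CategoryTheory
open Literature.AlgebraicGeometry.Motives Literature.AlgebraicGeometry.HodgeTheory
open Summit.HodgeConjecture.HodgeConjecture.Theses

/-- **Stub 1 statement — Mumford–Tate CM anchors** (verbatim the statement
`Cruxes/CMToAbelian/Lines/birth.lean § MumfordTateCMAnchors` registered on stmt-HodgeConjecture-16267
— a SHARED obligation). For every complex abelian variety `A` with a smooth-projectivity witness of
dimension `A.dim`, every `p` and every rational class `c` of Hodge type `(p,p)` in `H²ᵖ(A(ℂ); ℂ)`,
there exist a smooth projective family `f : 𝒳 ⟶ S` of relative dimension `A.dim` over a smooth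
irreducible `ℂ`-scheme `S` ALL of whose fibres over complex points are (underlying varieties of)
abelian varieties of dimension `A.dim`, complex points `s₁ s₀`, an isomorphism `e : A.X ≅ 𝒳_{s₁}`, a
class `W ∈ H²ᵖ(𝒳(ℂ); ℂ)` whose restriction to every fibre is rational of Hodge type `(p,p)` and with
`e^*(W|_{𝒳_{s₁}}) = c`, and an abelian variety `A₀` OF CM TYPE (a commutative reduced `ℚ`-subalgebra
of `End⁰(A₀)` of dimension `2 dim A₀` — the hypothesis of `RankFourFaces.CMAbelianHodge` verbatim)
with `A₀.dim = A.dim` and `A₀.X ≅ 𝒳_{s₀}`. (The Mumford–Tate family of `A` at neat level: Hodge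
classes of `A` extend flatly and stay Hodge, the flat section is the restriction of a global Hodge
class by the theorem of the fixed part, and special = CM points are dense — Deligne's reduction
step; a theorem in print.) [cite: CharlesSchnell2014Notes, Thm. 11.5.11]
[cite: Deligne1982HodgeCycles, Prop. 6.1] [cite: Mumford1969NoteShimura] -/
def MumfordTateCMAnchors : Prop :=
  ∀ (A : AbelianVariety ℂ), IsSmoothProjective A.dim A.X →
    ∀ (p : ℕ) (c : complexBetti A.X (2 * p)), IsRationalClass c →
      IsOfHodgeType A.dim A.X (2 * p) p p c →
        ∃ (𝒳 S : SchemeOver ℂ) (f : 𝒳 ⟶ S) (s₁ s₀ : ComplexPoints S) (e : A.X ≅ fiberOver f s₁)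
          (W : complexBetti 𝒳 (2 * p)) (A₀ : AbelianVariety ℂ),
          IsSmoothProjectiveFamily f A.dim ∧ IrreducibleSpace S.left ∧ AlgebraicGeometry.Smooth S.hom ∧
          (∀ s : ComplexPoints S, ∃ A' : AbelianVariety ℂ, A'.dim = A.dim ∧ Nonempty (A'.X ≅ fiberOver f s)) ∧
          (∀ s : ComplexPoints S, IsRationalClass (complexBetti.map (fiberι f s) (2 * p) W) ∧
            IsOfHodgeType A.dim (fiberOver f s) (2 * p) p p (complexBetti.map (fiberι f s) (2 * p) W)) ∧
          complexBetti.map e.hom (2 * p) (complexBetti.map (fiberι f s₁) (2 * p) W) = c ∧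
          A₀.dim = A.dim ∧ Nonempty (A₀.X ≅ fiberOver f s₀) ∧
          (∃ E : Subalgebra ℚ A₀.endAlgebra, IsReduced ↥E ∧ (∀ x ∈ E, ∀ y ∈ E, x * y = y * x) ∧
            Module.finrank ℚ ↥E = 2 * A₀.dim)

/-- **Stub 2 statement — the variational Hodge conjecture for abelian schemes** (verbatim the
statement `Cruxes/CMToAbelian/Lines/birth.lean § AbelianSchemeVHC` registered on
stmt-HodgeConjecture-16267 — a SHARED obligation). For a smooth projective family `f : 𝒳 ⟶ S` of
relative dimension `n` over a smooth irreducible `ℂ`-scheme `S` all of whose fibres over complex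
points are (underlying varieties of) abelian varieties of dimension `n`, every `p` and every class
`W ∈ H²ᵖ(𝒳(ℂ); ℂ)` whose restriction to every fibre is rational of Hodge type `(p,p)`: if
`W|_{𝒳_{s₀}}` is algebraic for ONE `s₀` then `W|_{𝒳_s}` is algebraic for EVERY `s`. The abelian-fibre
restriction of `AnchorTransport.VariationalHodge` (Grothendieck's variational Hodge conjecture,
global-class form). [cite: CharlesSchnell2014Notes, Conj. 11.3.1 and Prop. 11.3.5]
[cite: Grothendieck1966, footnote 13] [cite: Andre1996Motifs, Thm. 0.5] -/
def AbelianSchemeVHC : Prop :=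
  ∀ ⦃n : ℕ⦄ ⦃𝒳 S : SchemeOver ℂ⦄ (f : 𝒳 ⟶ S), IsSmoothProjectiveFamily f n → IrreducibleSpace S.left →
    AlgebraicGeometry.Smooth S.hom →
    (∀ s : ComplexPoints S, ∃ A' : AbelianVariety ℂ, A'.dim = n ∧ Nonempty (A'.X ≅ fiberOver f s)) →
    ∀ (p : ℕ) (W : complexBetti 𝒳 (2 * p)),
      (∀ s : ComplexPoints S, IsRationalClass (complexBetti.map (fiberι f s) (2 * p) W) ∧
        IsOfHodgeType n (fiberOver f s) (2 * p) p p (complexBetti.map (fiberι f s) (2 * p) W)) →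
      (∃ s₀ : ComplexPoints S,
        complexBetti.map (fiberι f s₀) (2 * p) W ∈ algebraicClasses (fiberOver f s₀) p) →
      ∀ s : ComplexPoints S, complexBetti.map (fiberι f s) (2 * p) W ∈ algebraicClasses (fiberOver f s) p

/-- **Stub 1 — Mumford–Tate CM anchors** (every Hodge class on a complex abelian variety deforms,
inside an abelian family over a smooth irreducible base and as the restriction of a global fibrewise
Hodge class, to a CM fibre — Deligne's reduction step; shared with crux `CMToAbelian`).
[cite: CharlesSchnell2014Notes, Thm. 11.5.11] [cite: Deligne1982HodgeCycles, Prop. 6.1]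
[cite: Mumford1969NoteShimura] -/
theorem stub_mumfordTateCMAnchors : MumfordTateCMAnchors := by
  sorry

/-- **Stub 2 — the variational Hodge conjecture for abelian schemes** (all codimensions; shared with
crux `CMToAbelian`). [cite: CharlesSchnell2014Notes, Conj. 11.3.1] [cite: Grothendieck1966, footnote 13] -/
theorem stub_abelianSchemeVHC : AbelianSchemeVHC := by
  sorry

/-! ## Name-keyed aliases of the two statements — the stub hypotheses of the skeleton theorem
The native skeleton audit (`ledger skeleton check` / `#h21_check_skeleton`) admits a hypothesis of the
skeleton theorem only if its head constant is a registered obligation (here: the tagged route item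
`RankFourFaces.CMAbelianHodge`) or is NAMED like a declared stub (`skeleton.extra-hypothesis`
otherwise); `__Registered.stub_X` is statement `X` under the registered stub's short name (device of
`Cruxes/CMToAbelian/Lines/birth.lean` and `Cruxes/AlgebraicDensity/Lines/birth.lean`; the `__`
namespace is an implementation detail — the gate-reserved `@[stub]` attribute is not written by a
planner). -/
namespace __Registered

/-- Alias of `MumfordTateCMAnchors` keyed by the registered stub name. -/
abbrev stub_mumfordTateCMAnchors : Prop := MumfordTateCMAnchors
/-- Alias of `AbelianSchemeVHC` keyed by the registered stub name. -/
abbrev stub_abelianSchemeVHC : Prop := AbelianSchemeVHC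

end __Registered

/-- **Deligne's reduction, composed (real proof).** Mumford–Tate CM anchors and variational Hodge
for abelian schemes give `RankFourFaces.CMToAbelian` — HC for CM abelian varieties implies HC for
every complex abelian variety — on the tree's carriers: `CMAbelianHodge` makes the CM fibre
`𝒳_{s₀} ≅ A₀.X` an algebraic anchor, stub 2 transports algebraicity to `𝒳_{s₁} ≅ A.X`, and the three
predicates of the Hodge conjecture are invariant under the isomorphisms `e₀`, `e` (`IsoTransport`);
the Hodge-model conjunct of `HodgeConjectureFor` is the tree theorem `nonempty_hodgeModel_holds`.
(The same composition as the sibling skeleton `CMToAbelian.Birth.CMToAbelian_of`; it is the seam of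
THIS skeleton, where the crux's dimension bound plays no role.) -/
theorem cmToAbelian_of :
    __Registered.stub_mumfordTateCMAnchors → __Registered.stub_abelianSchemeVHC →
      RankFourFaces.CMToAbelian := by
  intro hAn hV hCM A hA
  refine (hodgeConjectureFor_iff_of_isSmoothProjective nonempty_hodgeModel_holds hA).2 ?_
  intro p c hc hpp
  obtain ⟨𝒳, S, f, s₁, s₀, e, W, A₀, hf, hirr, hsm, hab, hW, hWc, hdim, ⟨e₀⟩, hE⟩ :=
    hAn A hA p c hc hpp
  -- the CM fibre: `A₀` is smooth projective of dimension `A₀.dim = A.dim` (transport along `e₀`)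
  have hA₀ : IsSmoothProjective A₀.dim A₀.X := by
    rw [hdim]
    exact (hf.isSmoothProjective s₀).of_iso e₀.symm
  -- `CMAbelianHodge` at `A₀`, moved to the fibre `𝒳_{s₀}` along `e₀`
  have h₀ : complexBetti.map (fiberι f s₀) (2 * p) W ∈ algebraicClasses (fiberOver f s₀) p := by
    have hHC := (hCM A₀ hA₀ hE).2 p
    rw [hdim] at hHC
    exact (forall_hodgeClass_mem_algebraicClasses_iff_of_iso e₀ p).1 hHC _ (hW s₀).1 (hW s₀).2
  -- stub 2: variational Hodge along the abelian family, from the CM fibre `s₀` to `s₁` …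
  have h₁ := hV f hf hirr hsm hab p W hW ⟨s₀, h₀⟩ s₁
  -- … and across the isomorphism `e : A.X ≅ 𝒳_{s₁}`
  rw [← hWc]
  exact (mem_algebraicClasses_map_iff_of_iso e).2 h₁

/-- **THE SKELETON THEOREM.** The two stub statements (name-keyed aliases) and the registered item
`RankFourFaces.CMAbelianHodge` (the Hodge conjecture for CM abelian varieties, stmt-HodgeConjecture-3052,
by name) give the crux `SevenfoldWeilCensus.HodgeAbelianDimGeEight`, concluded BY NAME: Deligne's
reduction `cmToAbelian_of` fed with `CMAbelianHodge`, restricted to dimension `≥ 8` (the bound is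
discarded — cf. `Cruxes/AbelianComplement/R1AbsorbsLowDim.lean`: R1 is equivalent to HC for all
complex abelian varieties). No `sorry` of its own; axioms `propext`, `Classical.choice`, `Quot.sound`. -/
theorem HodgeAbelianDimGeEight_of :
    __Registered.stub_mumfordTateCMAnchors → __Registered.stub_abelianSchemeVHC →
      RankFourFaces.CMAbelianHodge → SevenfoldWeilCensus.HodgeAbelianDimGeEight :=
  fun hAn hV hCM A _ hA => cmToAbelian_of hAn hV hCM A hA

/-- **The crux from its registered stubs** (conditional on the two sorried `stub_*` placeholders and,
as an explicit hypothesis by name, on the registered item `RankFourFaces.CMAbelianHodge`). -/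
theorem HodgeAbelianDimGeEight_of_stubs :
    RankFourFaces.CMAbelianHodge → SevenfoldWeilCensus.HodgeAbelianDimGeEight :=
  HodgeAbelianDimGeEight_of stub_mumfordTateCMAnchors stub_abelianSchemeVHC

end Summit.HodgeConjecture.HodgeConjecture.Cruxes.HodgeAbelianDimGeEight.Birth
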